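import Literature.MathematicalPhysics.QuantumFieldTheory.FariaDaVeigaOCarroll2022.FdVOC22MultiReflectionBound
import Literature.MathematicalPhysics.QuantumFieldTheory.ConstructiveQFTWave0OddRPProofs

/-!
HONEST FRAMING: exact (Metropolis-corrected) sampling algorithms for lattice gauge theory; figures
of merit are autocorrelation/cost numbers at stated couplings and volumes; no continuum-physics
claim.

# PlaquetteCorrelatorRP — THE TIMED PLAQUETTE FAMILY AND ITS TRUNCATED TEMPORAL CORRELATOR;
# ODD-TORUS REFLECTION POSITIVITY IN REAL FORM (lean-1 GEN-11, ours; part 1 of 3 of the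
# strong-coupling clustering floor (U″))

Venture-side (OURS). Cell `lqcd-flow` (pub-lqcd), unit `pub-lqcd-lean-1-g11`, 2026-08-23.

For a compact gauge group `G`, a continuous matrix representation `ρ`, `β ≥ 0`, the torus
`(ℤ/L)^d` and a SPATIAL plaquette orientation `0 < i < j` (time = coordinate `0`), let
`g(m) = ⟨P_0 P_m⟩ − ⟨P_0⟩⟨P_m⟩` be the truncated correlator of the plaquette `P = Re tr ρ(U_p)` at a
base site of time `0` with its translate by `m ∈ ℤ/L` time units (by translation invariance of the
Wilson measure — Literature `wilsonExpectation_comp_torusConfigShift` — `g` does not depend on the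
base site and `g(−m) = g(m)`).  From the THREE Osterwalder–Seiler reflection positivities of the
tree (links `t ↦ 1 − t` on even tori, sites `t ↦ −t` on even tori, the mixed reflection on odd tori —
`ConstructiveQFTWave0{,SiteRP,OddRP}Proofs`) and the Schwarz inequality of the reflection form
(Literature `FariaDaVeigaOCarroll2022.MultiReflection.sq_integral_mul_comp_le_of_rp`):

* §1 the odd-torus positivity in real form (`integral_mul_timeReflect_nonneg_odd`; the even-torus
  forms are Literature `FariaDaVeigaOCarroll2022.integral_mul_{timeReflect,negReflect}_nonneg`),
  translation of plaquette expectations, the centring identity `∫ (f − c)(h − c) = ∫ fh − c²`;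
* §2 the timed family `P_m` (`tObs`) and its truncated correlator `g` (`tCorr`): common mean,
  `⟨P_m P_{m'}⟩ = ⟨P_0 P_{m'−m}⟩`, **`∫ (P_m − c)(P_{m'} − c) dμ_β = g(m' − m)`**
  (`integral_centred_Pobs`), `g(−m) = g(m)` (`corr_neg`), and measurability / boundedness / support
  of `P_m − c` (`centred_Pobs_props`).  The Schwarz inequalities themselves are the sequel
  `PlaquetteCorrelatorLogConvex`; the floor is `ClusteringFloorStrongCoupling`.

NOT CLAIMED: temporal plaquettes or separations in a spatial direction (the tree's reflections are
in time; an axis permutation would transport the result); `β < 0`.  Literature grade (cell rule):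
known mechanism (reflection positivity ⇒ spectral/OS positivity ⇒ log-convexity of two-point
functions, e.g. Seiler LNP 159 Ch. 2, Glimm–Jaffe §6); new typing on the torus, no new theorem of
physics.
-/

noncomputable section

namespace Summit.Ventures.LatticeQCDFlow.Theory2.Clustering

open MeasureTheory Literature.MathematicalPhysics.QuantumFieldTheory
open Literature.MathematicalPhysics.QuantumFieldTheory.FariaDaVeigaOCarroll2022
open Literature.MathematicalPhysics.QuantumFieldTheory.FariaDaVeigaOCarroll2022.MultiReflection

/-! ## §1 Odd-torus positivity in real form; spatial plaquettes under `Θ`; the timed family -/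

section Basics

variable {d L N : ℕ} [NeZero d] [NeZero L] {G : Type*} [Group G] [TopologicalSpace G]
  [IsTopologicalGroup G] [CompactSpace G] [MeasurableSpace G] [BorelSpace G]
  [SecondCountableTopology G] (ρ : G →* Matrix (Fin N) (Fin N) ℂ)

omit [SecondCountableTopology G] in
/-- **Odd-torus reflection positivity, real form**: `0 ≤ ∫ F · F∘Θ dμ_{Λ,β}` for a bounded
measurable real observable of the links of the closed half `{1 ≤ t ≤ L/2 + 1}` of the odd torus
(`L` odd, `L ≥ 3`, `β ≥ 0`; Literature `wilsonExpectation_oddReflectionPositive`). -/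
theorem integral_mul_timeReflect_nonneg_odd (hL : Odd L) (hL3 : 3 ≤ L) (hρ : Continuous ρ)
    {β : ℝ} (hβ : 0 ≤ β) {F : GaugeConfig d L G → ℝ} (hFm : Measurable F)
    (hFb : ∃ K : ℝ, ∀ U, |F U| ≤ K)
    (hFdep : DependsOn F
      ((WilsonOddRP.oPosEdges ∪ WilsonOddRP.oSharedEdges : Finset (Edge d L)) : Set (Edge d L))) :
    0 ≤ ∫ U, F U * F U.timeReflect ∂(wilsonMeasure ρ β) := by
  obtain ⟨K, hK⟩ := hFb
  have hdep : DependsOn (fun U : GaugeConfig d L G => (F U : ℂ))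
      ((WilsonOddRP.oPosEdges ∪ WilsonOddRP.oSharedEdges : Finset (Edge d L)) : Set (Edge d L)) := by
    intro U V hUV
    simp only [Complex.ofReal_inj]
    exact hFdep hUV
  have h := wilsonExpectation_oddReflectionPositive ρ hL hL3 hρ hβ (fun U => (F U : ℂ))
    (Complex.measurable_ofReal.comp hFm) ⟨K, fun U => by
      rw [Complex.norm_real, Real.norm_eq_abs]; exact hK U⟩ hdep
  unfold wilsonExpectation at h
  have h' : (∫ U, (starRingEnd ℂ) ((F U.timeReflect : ℝ) : ℂ) * (F U : ℂ) ∂wilsonMeasure ρ β) =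
      ((∫ U, F U * F U.timeReflect ∂wilsonMeasure ρ β : ℝ) : ℂ) := by
    rw [← integral_complex_ofReal]
    refine integral_congr_ae (ae_of_all _ fun U => ?_)
    simp only [Complex.conj_ofReal]
    push_cast
    ring
  rw [h'] at h
  exact Complex.zero_le_real.1 h

omit [NeZero L] [Group G] [TopologicalSpace G] [IsTopologicalGroup G] [CompactSpace G]
  [MeasurableSpace G] [BorelSpace G] [SecondCountableTopology G] ρ in
/-- Time reflection of a time translate of a time-zero site: `θ(x + m e₀) = x + (1 − m) e₀`. -/
theorem timeReflect_add_single {x : Site d L} (hx : x 0 = 0) (m : ZMod L) :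
    (x + Pi.single (0 : Fin d) m).timeReflect = x + Pi.single (0 : Fin d) (1 - m) := by
  funext k
  by_cases hk : k = 0
  · subst hk
    simp [Site.timeReflect, hx]
  · simp [Site.timeReflect, hk]

omit [NeZero L] [Group G] [TopologicalSpace G] [IsTopologicalGroup G] [CompactSpace G]
  [MeasurableSpace G] [BorelSpace G] [SecondCountableTopology G] ρ in
/-- Site reflection of a time translate of a time-zero site: `θ'(x + m e₀) = x + (−m) e₀`. -/
theorem negReflect_add_single {x : Site d L} (hx : x 0 = 0) (m : ZMod L) :
    (x + Pi.single (0 : Fin d) m).negReflect = x + Pi.single (0 : Fin d) (-m) := by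
  funext k
  by_cases hk : k = 0
  · subst hk
    simp [Site.negReflect, hx]
  · simp [Site.negReflect, hk]

omit [NeZero L] [Group G] [TopologicalSpace G] [IsTopologicalGroup G] [CompactSpace G]
  [MeasurableSpace G] [BorelSpace G] [SecondCountableTopology G] ρ in
/-- The time coordinate of `x + m e₀` for a time-zero site. [folklore] -/
theorem add_single_apply_zero {x : Site d L} (hx : x 0 = 0) (m : ZMod L) :
    (x + Pi.single (0 : Fin d) m : Site d L) 0 = m := by
  simp [hx]

omit [NeZero L] [Group G] [TopologicalSpace G] [IsTopologicalGroup G] [CompactSpace G]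
  [MeasurableSpace G] [BorelSpace G] [SecondCountableTopology G] ρ in
/-- Spatial shifts do not change the time coordinate. [folklore] -/
theorem shift_apply_zero_of_ne (y : Site d L) {k : Fin d} (hk : k ≠ 0) : (y.shift k) 0 = y 0 := by
  simp [Site.shift, hk.symm]

omit [NeZero d] [NeZero L] [CompactSpace G] [MeasurableSpace G] [BorelSpace G]
  [SecondCountableTopology G] in
/-- The plaquette observable is continuous. [folklore] -/
theorem continuous_plaqObs (hρ : Continuous ρ) (y : Site d L) (i j : Fin d) :
    Continuous fun U : GaugeConfig d L G => (ρ (plaquetteHolonomy U y i j)).trace.re := by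
  have h1 : Continuous fun U : GaugeConfig d L G => plaquetteHolonomy U y i j := by
    unfold plaquetteHolonomy; fun_prop
  exact Complex.continuous_re.comp (hρ.comp h1).matrix_trace

omit [NeZero d] [NeZero L] [MeasurableSpace G] [BorelSpace G] [SecondCountableTopology G] in
/-- `|Re tr ρ(U_p)| ≤ N`. [folklore] -/
theorem abs_plaqObs_le (hρ : Continuous ρ) (U : GaugeConfig d L G) (y : Site d L) (i j : Fin d) :
    |(ρ (plaquetteHolonomy U y i j)).trace.re| ≤ N := by
  simpa using Literature.RepresentationTheory.CompactGroups.CompactGroup.abs_re_trace_le_card ρ hρ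
    (plaquetteHolonomy U y i j)

omit [NeZero L] [TopologicalSpace G] [IsTopologicalGroup G] [CompactSpace G] [MeasurableSpace G]
  [BorelSpace G] [SecondCountableTopology G] in
/-- The plaquette observable at `(y; i, j)` depends only on links based at time `y 0` in the
directions `i, j` or at the shifted sites — all of time coordinate `y 0` when `i, j ≠ 0`: if two
configurations agree on every spatial link `e` (direction `≠ 0`) with `e.1 0 = y 0`, the
observables agree. -/
theorem plaqObs_eq_of_agree {y : Site d L} {i j : Fin d} (hi : i ≠ 0) (hj : j ≠ 0)
    {U V : GaugeConfig d L G}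
    (h : ∀ e : Edge d L, e.2 ≠ 0 → e.1 0 = y 0 → U e = V e) :
    (ρ (plaquetteHolonomy U y i j)).trace.re = (ρ (plaquetteHolonomy V y i j)).trace.re := by
  have hi' := shift_apply_zero_of_ne y hi
  have hj' := shift_apply_zero_of_ne y hj
  simp only [plaquetteHolonomy, h (y, i) hi rfl, h (y.shift i, j) hj hi', h (y.shift j, i) hi hj',
    h (y, j) hj rfl]

omit [NeZero d] [SecondCountableTopology G] in
/-- **Translation**: expectations of time translates. `⟨P_{y+v}⟩ = ⟨P_y⟩` and
`⟨P_{y+v} P_{z+v}⟩ = ⟨P_y P_z⟩` (Literature `wilsonExpectation_comp_torusConfigShift`). -/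
theorem expect_plaqObs_add (β : ℝ) (y v : Site d L) (i j : Fin d) :
    wilsonExpectation ρ β (fun U : GaugeConfig d L G => (ρ (plaquetteHolonomy U (y + v) i j)).trace.re)
      = wilsonExpectation ρ β (fun U : GaugeConfig d L G => (ρ (plaquetteHolonomy U y i j)).trace.re) := by
  have h := wilsonExpectation_comp_torusConfigShift ρ β (-v)
    (fun U : GaugeConfig d L G => (ρ (plaquetteHolonomy U y i j)).trace.re)
  rw [← h]
  simp only [Function.comp_def, plaquetteHolonomy_torusConfigShift, sub_neg_eq_add]

omit [NeZero d] [SecondCountableTopology G] in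
/-- Translation of the pair expectation. -/
theorem expect_plaqObs_mul_add (β : ℝ) (y z v : Site d L) (i j : Fin d) :
    wilsonExpectation ρ β (fun U : GaugeConfig d L G =>
        (ρ (plaquetteHolonomy U (y + v) i j)).trace.re * (ρ (plaquetteHolonomy U (z + v) i j)).trace.re)
      = wilsonExpectation ρ β (fun U : GaugeConfig d L G =>
        (ρ (plaquetteHolonomy U y i j)).trace.re * (ρ (plaquetteHolonomy U z i j)).trace.re) := by
  have h := wilsonExpectation_comp_torusConfigShift ρ β (-v) (fun U : GaugeConfig d L G =>
    (ρ (plaquetteHolonomy U y i j)).trace.re * (ρ (plaquetteHolonomy U z i j)).trace.re)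
  rw [← h]
  simp only [Function.comp_def, plaquetteHolonomy_torusConfigShift, sub_neg_eq_add]

/-- **Centred products integrate to truncated correlators**: for bounded continuous `f, h` with the
same mean `c` under a probability measure, `∫ (f − c)(h − c) = ∫ f h − c²`. [folklore] -/
theorem integral_centred_mul {Ω : Type*} [MeasurableSpace Ω] {μ : Measure Ω} [IsProbabilityMeasure μ]
    {f h : Ω → ℝ} (hf : Integrable f μ) (hh : Integrable h μ) (hfh : Integrable (fun ω => f ω * h ω) μ)
    {c : ℝ} (hfc : ∫ ω, f ω ∂μ = c) (hhc : ∫ ω, h ω ∂μ = c) :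
    ∫ ω, (f ω - c) * (h ω - c) ∂μ = ∫ ω, f ω * h ω ∂μ - c * c := by
  have e1 : (fun ω => (f ω - c) * (h ω - c)) = fun ω => (f ω * h ω - c * f ω) - (c * h ω - c * c) := by
    funext ω; ring
  have i1 : Integrable (fun ω => f ω * h ω - c * f ω) μ := hfh.sub (hf.const_mul c)
  have i2 : Integrable (fun ω => c * h ω - c * c) μ := (hh.const_mul c).sub (integrable_const _)
  have i3 : Integrable (fun ω => c * f ω) μ := hf.const_mul c
  have i4 : Integrable (fun ω => c * h ω) μ := hh.const_mul c
  rw [e1, integral_sub i1 i2, integral_sub hfh i3, integral_sub i4 (integrable_const _),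
    integral_const_mul, integral_const_mul, integral_const, hfc, hhc, smul_eq_mul, probReal_univ,
    one_mul]
  ring

end Basics

/-! ## §2 The Schwarz inequalities of the three reflections for the timed plaquette family -/

section RP

variable {d L N : ℕ} [NeZero d] [NeZero L] {G : Type*} [Group G] [TopologicalSpace G]
  [IsTopologicalGroup G] [CompactSpace G] [MeasurableSpace G] [BorelSpace G]
  [SecondCountableTopology G] (ρ : G →* Matrix (Fin N) (Fin N) ℂ)

/-- **The timed plaquette observable** `P_m(U) = Re tr ρ(U_{(x + m e₀; i, j)})`: the plaquette in
the `(i, j)` plane based at the site `x` translated by `m ∈ ℤ/L` units of time (coordinate `0`). -/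
def tObs (x : Site d L) (i j : Fin d) (m : ZMod L) (U : GaugeConfig d L G) : ℝ :=
  (ρ (plaquetteHolonomy U (x + Pi.single (0 : Fin d) m) i j)).trace.re

/-- **The truncated temporal correlator** `g(m) = ⟨P_0 P_m⟩_β − ⟨P_0⟩_β ⟨P_m⟩_β` of the timed family. -/
def tCorr (β : ℝ) (x : Site d L) (i j : Fin d) (m : ZMod L) : ℝ :=
  wilsonExpectation ρ β (fun U : GaugeConfig d L G => tObs ρ x i j 0 U * tObs ρ x i j m U)
    - wilsonExpectation ρ β (tObs ρ x i j 0) * wilsonExpectation ρ β (tObs ρ x i j m)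

omit [NeZero L] [TopologicalSpace G] [IsTopologicalGroup G] [CompactSpace G] [MeasurableSpace G]
  [BorelSpace G] [SecondCountableTopology G] in
/-- `P_0` is the plaquette observable at the base site. -/
theorem tObs_zero (x : Site d L) (i j : Fin d) (U : GaugeConfig d L G) :
    tObs ρ x i j 0 U = (ρ (plaquetteHolonomy U x i j)).trace.re := by
  simp [tObs]

omit [NeZero L] [CompactSpace G] [MeasurableSpace G] [BorelSpace G] [SecondCountableTopology G] in
/-- The timed plaquette observable is continuous. [folklore] -/
theorem continuous_tObs (hρ : Continuous ρ) (x : Site d L) (i j : Fin d) (m : ZMod L) :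
    Continuous (tObs ρ x i j m) := by
  unfold tObs
  exact continuous_plaqObs ρ hρ _ i j

omit [SecondCountableTopology G] in
/-- All timed plaquettes have the same mean. -/
theorem expect_Pobs (β : ℝ) (x : Site d L) (i j : Fin d) (m : ZMod L) :
    wilsonExpectation ρ β (tObs ρ x i j m) = wilsonExpectation ρ β (tObs ρ x i j 0) := by
  have h := expect_plaqObs_add ρ β x (Pi.single (0 : Fin d) m) i j
  unfold tObs
  simp only [Pi.single_zero, add_zero]
  exact h

omit [SecondCountableTopology G] in
/-- The pair expectation depends only on the time difference: `⟨P_m P_{m'}⟩ = ⟨P_0 P_{m'−m}⟩`. -/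
theorem expect_Pobs_mul (β : ℝ) (x : Site d L) (i j : Fin d) (m m' : ZMod L) :
    wilsonExpectation ρ β (fun U : GaugeConfig d L G => tObs ρ x i j m U * tObs ρ x i j m' U)
      = wilsonExpectation ρ β (fun U : GaugeConfig d L G => tObs ρ x i j 0 U * tObs ρ x i j (m' - m) U) := by
  have h := expect_plaqObs_mul_add ρ β x (x + Pi.single (0 : Fin d) (m' - m)) (Pi.single (0 : Fin d) m) i j
  have e : x + Pi.single (0 : Fin d) (m' - m) + Pi.single (0 : Fin d) m
      = (x + Pi.single (0 : Fin d) m' : Site d L) := by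
    rw [add_assoc, ← Pi.single_add, sub_add_cancel]
  rw [e] at h
  unfold tObs
  simp only [Pi.single_zero, add_zero]
  exact h

/-- **The centred pair integral is the truncated correlator at the time difference**:
`∫ (P_m − c)(P_{m'} − c) dμ_β = g(m' − m)`, `c` the common mean. -/
theorem integral_centred_Pobs (hρ : Continuous ρ) (β : ℝ) (x : Site d L) (i j : Fin d)
    (m m' : ZMod L) :
    ∫ U, (tObs ρ x i j m U - wilsonExpectation ρ β (tObs ρ x i j 0))
        * (tObs ρ x i j m' U - wilsonExpectation ρ β (tObs ρ x i j 0)) ∂(wilsonMeasure ρ β)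
      = tCorr ρ β x i j (m' - m) := by
  haveI := isProbabilityMeasure_wilsonMeasure (d := d) (L := L) ρ hρ β
  have hc : ∀ n : ZMod L, Continuous (tObs ρ x i j n) := fun n => continuous_tObs ρ hρ x i j n
  have hint : ∀ n : ZMod L, Integrable (tObs ρ x i j n) (wilsonMeasure ρ β) := fun n =>
    (hc n).integrable_of_hasCompactSupport (HasCompactSupport.of_compactSpace _)
  have hint2 : ∀ n n' : ZMod L, Integrable (fun U => tObs ρ x i j n U * tObs ρ x i j n' U)
      (wilsonMeasure ρ β) := fun n n' =>
    ((hc n).mul (hc n')).integrable_of_hasCompactSupport (HasCompactSupport.of_compactSpace _)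
  have h := integral_centred_mul (μ := wilsonMeasure ρ β) (hint m) (hint m') (hint2 m m')
    (c := wilsonExpectation ρ β (tObs ρ x i j 0))
    (by have := expect_Pobs ρ β x i j m; unfold wilsonExpectation at this ⊢; exact this)
    (by have := expect_Pobs ρ β x i j m'; unfold wilsonExpectation at this ⊢; exact this)
  rw [h]
  have h2 := expect_Pobs_mul ρ β x i j m m'
  have h3 := expect_Pobs ρ β x i j (m' - m)
  unfold tCorr
  rw [← h2, h3]
  rfl

omit [SecondCountableTopology G] in
/-- **Evenness**: `g(−m) = g(m)`. -/
theorem corr_neg (β : ℝ) (x : Site d L) (i j : Fin d) (m : ZMod L) :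
    tCorr ρ β x i j (-m) = tCorr ρ β x i j m := by
  have h1 := expect_Pobs_mul ρ β x i j m 0
  have h2 : wilsonExpectation ρ β (fun U : GaugeConfig d L G => tObs ρ x i j m U * tObs ρ x i j 0 U)
      = wilsonExpectation ρ β (fun U : GaugeConfig d L G => tObs ρ x i j 0 U * tObs ρ x i j m U) := by
    congr 1; funext U; ring
  simp only [zero_sub] at h1
  unfold tCorr
  rw [← h1, h2, expect_Pobs ρ β x i j (-m), expect_Pobs ρ β x i j m]

/-- Measurability, boundedness and support of the centred timed observable. -/
theorem centred_Pobs_props (hρ : Continuous ρ) (x : Site d L) {i j : Fin d} (hi : i ≠ 0)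
    (hj : j ≠ 0) (m : ZMod L) (c : ℝ) :
    Measurable (fun U : GaugeConfig d L G => tObs ρ x i j m U - c)
      ∧ (∃ K : ℝ, ∀ U : GaugeConfig d L G, |tObs ρ x i j m U - c| ≤ K)
      ∧ DependsOn (fun U : GaugeConfig d L G => tObs ρ x i j m U - c)
          {e : Edge d L | e.2 ≠ 0 ∧ e.1 0 = (x + Pi.single (0 : Fin d) m : Site d L) 0} := by
  unfold tObs
  refine ⟨((continuous_plaqObs ρ hρ _ i j).sub continuous_const).measurable,
    ⟨N + |c|, fun U => ?_⟩, fun U V hUV => ?_⟩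
  · have h' := abs_le.1 (abs_plaqObs_le ρ hρ U (x + Pi.single (0 : Fin d) m) i j)
    exact abs_le.2 ⟨by linarith [h'.1, neg_abs_le c, le_abs_self c],
      by linarith [h'.2, neg_abs_le c, le_abs_self c]⟩
  · simp only [sub_left_inj]
    exact plaqObs_eq_of_agree ρ hi hj fun e he2 he1 => hUV e ⟨he2, he1⟩

end RP

end Summit.Ventures.LatticeQCDFlow.Theory2.Clustering
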